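import Summits.KontsevichZagierPeriods.Zeta5Search.Barrier.ConeGammaCuspPeriodFarkas

/-!
# ζ(5) search — BARRIER: THE CHAMBER FARKAS CERTIFICATE — seven multipliers suffice

HONEST FRAMING (cell `pub-zeta5`): systematic search; no irrationality claim unless kernel-certified. MODEL objects
under Brown–Zudilin's (28)+(30) accounting ([BZ22] = arXiv:2210.03391; (28) observed, not proved); nothing here is a
statement about `ζ(5)`, any `γ` of record, the cone's supremum (C2 OPEN) or the value / sign of the cusp slope or of a
multiplier at a named direction (DATA of the cell); NO certificate instance is asserted for any named direction; S-E
stays CONJECTURED; records in print UNMOVED. Prover P2 g34, item «GORDAN'S ALTERNATIVE FOR THE CUSP SLOPE», file (4)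
(theorems only).

* `gapVec_orth_sParam` — every wall-gap gradient `∇(r_l − r_k)` kills the radial displacement `s(a)` (all 28 rates of
  `s(a)` are `1`), so the gap gradients lie in the hyperplane `⟂ s(a)`, of dimension `7`
  (`exists_dotLinear_finrank_ker_le_seven`);
* **`exists_sparse_farkas_certificate`** — CONIC CARATHÉODORY (the tree's `Literature.Analysis.Convex.caratheodory_cone`,
  Schrijver 1986 Cor. 7.1i): a chamber Farkas certificate `Σ_k W_k·r_k + Σ_{ρk<ρl} μ_{kl}·(r_l − r_k) ≡ 0`, `μ ≥ 0`, can
  always be replaced by one with AT MOST SEVEN non-zero multipliers, sitting on linearly independent wall gaps — for any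
  weights `W`, any reference order `ρ`, all 28 forms of `a` positive;
* **`forall_cuspSlope_nonpos_iff_forall_sparse_farkas_certificate`** (+ `_canonical`) — A CUSP TOP, EXACTLY: `σ ≤ 0` in
  every direction IFF every generic reference carries a Farkas certificate with at most seven multipliers (file (3)'s
  criterion, sparsified).
DESK (DATA, `HOME/pub-zeta5-p2/g34/alg/farkas.py`): at record/41, flag/60, argmax-120, t*/480 the optimal duals of the
chamber LP have EXACTLY 7 non-zero multipliers in 592/592 certified chambers — the bound of this file, observed. NOT here:
any multiplier at a named direction; `γ`, C2, S-E, `ζ(5)`.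
-/

noncomputable section

open Set MeasureTheory Finset
open scoped Topology

namespace Summit.KontsevichZagierPeriods.Zeta5Search.Barrier.ConeGamma

/-! ### The wall-gap gradients lie in the hyperplane orthogonal to `s(a)` -/

/-- A rate on the coordinate displacements: `r_k(y) = Σ_p y_p · r_k(e_p)`. -/
theorem rate_eq_sum_coord (a : Dir) (y : Fin 8 → ℝ) (k : Fin 28) :
    phiForm y k / h28 a k = ∑ p, y p * (phiForm (Pi.single p (1 : ℝ)) k / h28 a k) := by
  rw [phiForm_eq_sum_coord y k, Finset.sum_div]
  exact Finset.sum_congr rfl fun p _ => by ring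

/-- **Every selected wall-gap gradient kills `s(a)`**: `Σ_p s(a)_p · [c]·(r_l(e_p) − r_k(e_p)) = 0` (all forms of `a`
positive — the 28 rates of `s(a)` are all `1`). -/
theorem gapVec_orth_sParam {a : Dir} (hpos : ∀ k, 0 < h28 a k) (c : Prop) [Decidable c] (k l : Fin 28) :
    ∑ p, sParam a p * (if c then phiForm (Pi.single p (1 : ℝ)) l / h28 a l -
      phiForm (Pi.single p (1 : ℝ)) k / h28 a k else 0) = 0 := by
  split_ifs
  · simp_rw [mul_sub]
    rw [Finset.sum_sub_distrib, ← rate_eq_sum_coord, ← rate_eq_sum_coord, phiForm_sParam, phiForm_sParam,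
      div_self (hpos l).ne', div_self (hpos k).ne', sub_self]
  · simp

/-! ### Conic Carathéodory: at most seven multipliers -/

/-- **A CHAMBER FARKAS CERTIFICATE NEEDS AT MOST SEVEN MULTIPLIERS.** All 28 forms of `a` positive; `W` any weights, `ρ`
any reference rates, `μ ≥ 0` multipliers on the pairs `ρ k < ρ l` with `Σ_k W_k·r_k(δ) + Σ_{ρk<ρl} μ_{kl}·(r_l(δ) − r_k(δ)) = 0`
for every `δ`. Then there are multipliers `μ' ≥ 0` with the same identity and AT MOST SEVEN non-zero entries: by the
tree's conic Carathéodory (`Literature.Analysis.Convex.caratheodory_cone`) the combination `Σ μ_{kl}·∇(r_l − r_k)` is a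
positive combination of LINEARLY INDEPENDENT gap gradients, and these lie in the hyperplane `⟂ s(a)` (`gapVec_orth_sParam`),
of dimension `7`. -/
theorem exists_sparse_farkas_certificate {a : Dir} (hpos : ∀ k, 0 < h28 a k) (W : Fin 28 → ℝ) (ρ : Fin 28 → ℝ)
    {μ : Fin 28 → Fin 28 → ℝ} (hμ : ∀ k l, 0 ≤ μ k l)
    (hid : ∀ δ : Fin 8 → ℝ, ∑ k, W k * (phiForm δ k / h28 a k) +
      ∑ k, ∑ l, (if ρ k < ρ l then μ k l * (phiForm δ l / h28 a l - phiForm δ k / h28 a k) else 0) = 0) :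
    ∃ μ' : Fin 28 → Fin 28 → ℝ, (∀ k l, 0 ≤ μ' k l) ∧
      ((Finset.univ : Finset (Fin 28 × Fin 28)).filter fun kl => μ' kl.1 kl.2 ≠ 0).card ≤ 7 ∧
      ∀ δ : Fin 8 → ℝ, ∑ k, W k * (phiForm δ k / h28 a k) +
        ∑ k, ∑ l, (if ρ k < ρ l then μ' k l * (phiForm δ l / h28 a l - phiForm δ k / h28 a k) else 0) = 0 := by
  classical
  -- the selected gap gradients
  obtain ⟨v, hv⟩ : ∃ v : Fin 28 × Fin 28 → Fin 8 → ℝ, ∀ kl p, v kl p =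
      if ρ kl.1 < ρ kl.2 then phiForm (Pi.single p (1 : ℝ)) kl.2 / h28 a kl.2 -
        phiForm (Pi.single p (1 : ℝ)) kl.1 / h28 a kl.1 else 0 := ⟨_, fun _ _ => rfl⟩
  -- the multiplier double sum at a coordinate displacement is a coordinate of `Σ μ • v`
  have hsum : ∀ (ν : Fin 28 → Fin 28 → ℝ) (p : Fin 8),
      ∑ k, ∑ l, (if ρ k < ρ l then ν k l * (phiForm (Pi.single p (1 : ℝ)) l / h28 a l -
        phiForm (Pi.single p (1 : ℝ)) k / h28 a k) else 0) =
      (∑ kl : Fin 28 × Fin 28, ν kl.1 kl.2 • v kl) p := fun ν p => by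
    rw [Finset.sum_apply, Fintype.sum_prod_type]
    refine Finset.sum_congr rfl fun k _ => Finset.sum_congr rfl fun l _ => ?_
    rw [Pi.smul_apply, smul_eq_mul, hv]
    split_ifs <;> simp
  -- conic Carathéodory
  obtain ⟨s, -, hind, c', hc'pos, hc'sum⟩ := Literature.Analysis.Convex.caratheodory_cone (𝕜 := ℝ) v Finset.univ
    (fun kl => μ kl.1 kl.2) fun kl _ => hμ kl.1 kl.2
  -- the independent gap gradients lie in the hyperplane orthogonal to `s(a)`: at most seven of them
  have hc : sParam a ≠ 0 := fun h => by
    have h0 := phiForm_sParam a 0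
    rw [h, ← zero_smul ℝ (sParam a), phiForm_smul, zero_mul] at h0
    exact (hpos 0).ne' h0.symm
  obtain ⟨ℓ, hℓ, hker⟩ := exists_dotLinear_finrank_ker_le_seven hc
  have hvker : ∀ kl, v kl ∈ LinearMap.ker ℓ := fun kl => by
    rw [LinearMap.mem_ker, hℓ]
    simp only [hv]
    exact gapVec_orth_sParam hpos _ kl.1 kl.2
  have hcard : s.card ≤ 7 := by
    have hli : LinearIndependent ℝ (fun i : ↥s => v (i : Fin 28 × Fin 28)) := hind
    have h1 := finrank_span_eq_card hli
    have h2 : Submodule.span ℝ (Set.range fun i : ↥s => v (i : Fin 28 × Fin 28)) ≤ LinearMap.ker ℓ :=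
      Submodule.span_le.mpr (by rintro _ ⟨i, rfl⟩; exact hvker _)
    have h3 := Submodule.finrank_mono h2
    rw [h1, Fintype.card_coe] at h3
    exact h3.trans hker
  -- the sparse multipliers
  refine ⟨fun k l => if (k, l) ∈ s then c' (k, l) else 0, fun k l => ?_, ?_, ?_⟩
  · show 0 ≤ (if (k, l) ∈ s then c' (k, l) else 0)
    split_ifs with h
    · exact (hc'pos _ h).le
    · exact le_rfl
  · refine (Finset.card_le_card ?_).trans hcard
    intro kl hkl
    have h : (if (kl.1, kl.2) ∈ s then c' (kl.1, kl.2) else 0) ≠ 0 := (Finset.mem_filter.mp hkl).2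
    by_contra hs
    exact h (by rw [Prod.mk.eta, if_neg hs])
  · -- the identity: on the coordinates the new multiplier sum is the same vector as the old one
    rw [chamberFarkas_forall_iff_coord]
    have hid' := (chamberFarkas_forall_iff_coord a (fun k l => ρ k < ρ l) W μ).mp hid
    intro p
    have h1 := hsum (fun k l => if (k, l) ∈ s then c' (k, l) else 0) p
    have h2 := hsum μ p
    have hvec : (∑ kl : Fin 28 × Fin 28, (if (kl.1, kl.2) ∈ s then c' (kl.1, kl.2) else 0) • v kl) =
        ∑ kl : Fin 28 × Fin 28, μ kl.1 kl.2 • v kl := by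
      rw [← hc'sum]
      simp only [Prod.mk.eta, ite_smul, zero_smul, Finset.sum_ite_mem, Finset.univ_inter]
    rw [h1, hvec, ← h2]
    exact hid' p

/-! ### A cusp top, exactly, with seven multipliers per chamber -/

/-- **A CUSP TOP, EXACTLY — SPARSE FARKAS FORM** (any period pattern function, any extension, no type). All 28 forms of `a`
positive, `T > 0` a period: `cuspSlope a T δ ≤ 0` for every `δ` IFF every generic reference `δ₀` carries a Farkas
certificate `μ ≥ 0`, `Σ_k W_k(δ₀)·r_k + Σ_{ρ₀k<ρ₀l} μ_{kl}(r_l − r_k) ≡ 0`, with AT MOST SEVEN non-zero multipliers. -/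
theorem forall_cuspSlope_nonpos_iff_forall_sparse_farkas_certificate {a : Dir} (hpos : ∀ k, 0 < h28 a k) {T : ℝ}
    (hT : 0 < T) (hper : ∀ k : Fin 28, ∃ z : ℤ, T * h28 a k = z)
    {M : ℕ → Finset (Fin 28)} {f : ℕ → Finset (Fin 28) → ℝ}
    (hf : ∀ m, m + 1 < (bkpts a T).card → ∀ Δ : Fin 8 → ℝ, (∀ k, |phiForm Δ k| < 1) →
      (∀ k, |phiForm Δ k| < wallDist a T) →
        (torusN (bkpt a T m • sParam a + Δ) : ℝ) = f m ((M m).filter fun k => 0 ≤ phiForm Δ k))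
    {F : Finset (Fin 28) → ℝ} (hF : ∀ A, F A = ∑ m ∈ Finset.range ((bkpts a T).card - 1), f m (A ∩ M m)) :
    (∀ δ, cuspSlope a T δ ≤ 0) ↔
      ∀ δ₀ : Fin 8 → ℝ, (∀ k l : Fin 28, k ≠ l → phiForm δ₀ k / h28 a k ≠ phiForm δ₀ l / h28 a l) →
        ∃ μ : Fin 28 → Fin 28 → ℝ, (∀ k l, 0 ≤ μ k l) ∧
          ((Finset.univ : Finset (Fin 28 × Fin 28)).filter fun kl => μ kl.1 kl.2 ≠ 0).card ≤ 7 ∧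
          ∀ δ : Fin 8 → ℝ,
            ∑ k, (F (Finset.univ.filter fun l => phiForm δ₀ k / h28 a k ≤ phiForm δ₀ l / h28 a l) -
                F (Finset.univ.filter fun l => phiForm δ₀ k / h28 a k < phiForm δ₀ l / h28 a l)) *
              (phiForm δ k / h28 a k) +
            ∑ k, ∑ l, (if phiForm δ₀ k / h28 a k < phiForm δ₀ l / h28 a l then
              μ k l * (phiForm δ l / h28 a l - phiForm δ k / h28 a k) else 0) = 0 := by
  rw [forall_cuspSlope_nonpos_iff_forall_farkas_certificate hpos hT hper hf hF]
  refine forall_congr' fun δ₀ => forall_congr' fun _ => ⟨?_, ?_⟩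
  · rintro ⟨μ, hμ, hid⟩
    exact exists_sparse_farkas_certificate hpos _ (fun k => phiForm δ₀ k / h28 a k) hμ hid
  · rintro ⟨μ, hμ, -, hid⟩
    exact ⟨μ, hμ, hid⟩

/-- **A CUSP TOP, EXACTLY — SPARSE FARKAS FORM, CANONICAL** (`F = Σ_m patternN a b_m`; hpos / hT / hper / hF only). -/
theorem forall_cuspSlope_nonpos_iff_forall_sparse_farkas_certificate_canonical {a : Dir} (hpos : ∀ k, 0 < h28 a k)
    {T : ℝ} (hT : 0 < T) (hper : ∀ k : Fin 28, ∃ z : ℤ, T * h28 a k = z) {F : Finset (Fin 28) → ℝ}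
    (hF : ∀ A, F A = ∑ m ∈ Finset.range ((bkpts a T).card - 1), ((patternN a (bkpt a T m) A : ℤ) : ℝ)) :
    (∀ δ, cuspSlope a T δ ≤ 0) ↔
      ∀ δ₀ : Fin 8 → ℝ, (∀ k l : Fin 28, k ≠ l → phiForm δ₀ k / h28 a k ≠ phiForm δ₀ l / h28 a l) →
        ∃ μ : Fin 28 → Fin 28 → ℝ, (∀ k l, 0 ≤ μ k l) ∧
          ((Finset.univ : Finset (Fin 28 × Fin 28)).filter fun kl => μ kl.1 kl.2 ≠ 0).card ≤ 7 ∧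
          ∀ δ : Fin 8 → ℝ,
            ∑ k, (F (Finset.univ.filter fun l => phiForm δ₀ k / h28 a k ≤ phiForm δ₀ l / h28 a l) -
                F (Finset.univ.filter fun l => phiForm δ₀ k / h28 a k < phiForm δ₀ l / h28 a l)) *
              (phiForm δ k / h28 a k) +
            ∑ k, ∑ l, (if phiForm δ₀ k / h28 a k < phiForm δ₀ l / h28 a l then
              μ k l * (phiForm δ l / h28 a l - phiForm δ k / h28 a k) else 0) = 0 := by
  classical
  exact forall_cuspSlope_nonpos_iff_forall_sparse_farkas_certificate hpos hT hper
    (M := fun m => Finset.univ.filter fun k => ∃ z : ℤ, bkpt a T m * h28 a k = z)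
    (f := fun m A => ((patternN a (bkpt a T m) A : ℤ) : ℝ)) (canonical_junction_agreement a T)
    (canonical_period_eq_sum_inter hF)

end Summit.KontsevichZagierPeriods.Zeta5Search.Barrier.ConeGamma

end
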